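import Summits.QuantumFields.YangMills.Theorems.BalabanUVNodesSpineReadingOfRecord13CoPHKFloorVolume
import Summits.QuantumFields.YangMills.Theorems.BalabanUVNodesN21KeyedShellWeightShellZero
import Literature.MathematicalPhysics.QuantumFieldTheory.Balaban1983to89.Node00.TwoRunSiteComponentSize

/-!
# THE COMPONENT-SIZE («OVER-AGE») BAD-KEY READING OF THE SPINE READING OF RECORD — `YMDAG.UVSplit.badKeyReadingOfBigComponent₁₃ N K₀ jcut big : BadKeyReading₁₃ N K₀`:
# a key is BAD iff at some level `1 ≤ j ≤ jcut` of its own step its large-field region `Z_j` has a connected component BIG for that level (`Node00.KeyBigOldComponent`, the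
# size criterion `big` a DIAL); every dial value is a SUB-class of the level-cut bad class of record, so ANY `RelWeightBound` at the pin descends to it; the `⊤` dial IS the
# pin's bad reading, the `⊥` dial books nothing (the free face at every key reading and every cut)

Cell `pub-ymgap`, YM-PLAN Track A (HUMAN RULING D-0062; width push D-0149); seat `pub-ymgap-dag-n20-d` (R134 (a) N20 NE7b s3 = the U5d ∕ `crOfRecord₁₃` lineage, its declarer)
gen 32; companion of `Thm/BalabanUVNodesSpineReadingOfRecord13CoPHK` (p608328: `KeyReading₁₃ ∕ BadKeyReading₁₃ ∕ classSetK₁₃ ∕ badClassK₁₃ ∕ weightAK₁₃ ∕ crOfRecord₁₃KAt ∕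
keyReadingId₁₃ ∕ badKeyReadingOfCut₁₃ ∕ crOfRecord₁₃KAt_id`), `…CoPHKFloorVolume` (p620111: `mem_classSetK₁₃_iff`) and `Literature/…/Node00/TwoRunSiteComponentSize` (this
generation: `compIn ∕ HasBigComponent ∕ KeyBigOldComponent ∕ bigOfCard`).  `--kind definition --supports stmt-QuantumFields-27366 --as helper` (K3⁸); COUNT-NEUTRAL.  Bus: INTENT-1
(pub-ymgap INBOX l.45552), dag-lead g20 DEDUP GO ×2 (l.45585).
WHY.  Row 2 of K3⁸'s stub 2 (`KeyedRelWeight cr`, `T4WeightBudget.RelWeightBound` at the reading's carriers) is met at the pin only at the cut-zero corner and WALLED at every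
policy with `1 ≤ jc K` frequently under first-level saturation (dag-n20-w1 `…N20KeyedRelWeightPolicyWall`, p597932; this seat's POSITION, INBOX l.44776): at the (2.18) key «old
large-field structure» is EXTENSIVE.  Print's bad terms are «OLD PENDING structure» and pendency is SIZE ([LF-II] (1.80)–(1.81) pp.384–385: `K_j(Z) ≤ n₀(Z) − j + R_j`); the
Literature companion types the per-component size reading `KeyBigOldComponent τ big jcut` with the size criterion a dial.  This file makes it a `BadKeyReading₁₃` VALUE for
`crOfRecord₁₃KAt` and proves its dictionary — so that the N20 ∕ N19′ pens (dag-n20-w2's reserved «further bad-key reading» for (AC), `…N20KeyedRelWeightAtForgivingKey` header;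
dag-n19-w1's age-cut letters, `…N19AgeCutRoad`) can book «old AND big» at a reading of record instead of «old».
WHAT IS HERE (1 `abbrev` = a TYPE, 2 `def`s = dial VALUES, theorems).  §1 `BigDial₁₃ N K₀` (per tuple, per step, per level a predicate on sets of finest sites — the TYPE only),
`badKeyReadingOfBigComponent₁₃ N K₀ jcut big` (the reading), `bigDialOfCard₁₃ K₀ m` (the cardinality instance: threshold `m K j` finest sites at level `j` of step `K`); §2 at ANY key
reading `kr`: membership (`mem_bad_bigComponent_iff`), ★ `bad_bigComponent_subset_bad_cut` (every dial value is a SUB-class of the level-cut class at the same cut), monotone in the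
cut ∕ in the dial, ★ `bad_bigComponent_top_eq_bad_cut` (the `⊤` dial IS the level-cut reading), ★ `bad_bigComponent_bot_eq_empty` (the `⊥` dial books nothing); §3 ★★
`relWeightBound_bigComponent_of_cut` (ANY witness `W` at the level-cut bad class is a witness at every size dial, same `W` — `T4BadClassBooking.relWeightBound_mono` BY NAME with
the coarse weights' non-negativity under core provisos), ★ `relWeightBound_bigComponent_bot` (the free face: `W := 0` at the `⊥` dial, every `kr`, every cut, every tuple), the same two
at the reading `crOfRecord₁₃KAt K₀ kr (badKeyReadingOfBigComponent₁₃ …) sh` (canonical `W`), and ★ `crOfRecord₁₃KAt_bigComponent_top` ∕ `crOfRecord₁₃KAt_id_bigComponent_top` (the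
`⊤` dial gives back the cut reading ∕ at the identity dial the V edition `crOfRecord₁₃VAt K₀ jcut sh` — v5's pin; dag-n21-d's `relWeightBound_crGap2₁₃VAt_iff_crOfRecord₁₃VAt`
carries row 2 between it and the K3⁸ v7 pin below the top cut); §4 the cardinality instance: thresholds `0` give the cut reading back, thresholds above the number of finest sites book
nothing, antitone in the thresholds.
HONEST FRAMING.  DEFINITIONS (dial values) + [folklore] finite-set bookkeeping BY NAME; NO weight is bounded, NO estimate proved; which size dial (if any) books a summable relative
weight under Bałaban's densities is a Peierls-type COUNT, NOT PRINTED as a two-run statement, NOT proved, NOT displayed as a hypothesis here; the proxy {over-aged pending} ⊆ {old-big}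
is print's (1.81) read qualitatively (Literature companion's header), not a theorem; nothing of Bałaban's asserted; NE7 ∕ NE7b ∕ NE7c NOT PRINTED for `d = 4` ∕ NOT proved; no
`Provisos₁₃CoPH` inhabitant claimed (K0⁷ OPEN); K3⁸ v7 untouched (a dial VALUE; nothing re-pinned, no stub text assumed); N19 ∕ N20 ∕ N21 ∕ N27 NOT discharged; counts UNMOVED
(typed 28∕28 · discharged 8∕27); one finite four-torus programme at fixed `ε` — NOT ℝ⁴, NOT OS, NOT a mass gap, NOT the Clay problem.  No decl below carries a cite tag.
-/

noncomputable section

open scoped BigOperators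
open Finset

namespace YMDAG.UVSplit

open Literature.MathematicalPhysics.QuantumFieldTheory.Balaban1983to89
open Literature.MathematicalPhysics.QuantumFieldTheory.Balaban1983to89.T4Continuum
open Literature.MathematicalPhysics.QuantumFieldTheory.Balaban1983to89.Node00
open T4WeightBudget (RelWeightBound)
open T4BadClassBooking (relWeightBound_mono)
open Summit.QuantumFields.YangMills.BalabanUVNodes.N21KeyedShellWeightShellZero (weightA₁₃_nonneg weightB₁₃_nonneg)

variable {F : T4Family} {N : ℕ} [NeZero N]

/-! ## §1 The dial type, the reading, the cardinality instance -/

/-- **A SIZE DIAL** («which components are big»): per tuple `(F, θ, hP, g₀, os)`, per step `K` and per level `j`, a predicate on sets of finest sites of the step-`(K₀ + K)` torus.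
The TYPE only. [bookkeeping] -/
abbrev BigDial₁₃ (N : ℕ) [NeZero N] (K₀ : ℕ) : Type 1 :=
  (F : T4Family) → (θ : Stage13HParams F N) → θ.Provisos₁₃CoPH F N → (ℕ → ℝ) → List (ULoop F) → (K : ℕ) → ℕ → Set (Site (F.P (K₀ + K)) 0) → Prop

/-- **THE COMPONENT-SIZE («OVER-AGE») BAD-KEY READING** with level cut `jcut` and size dial `big`: a key is bad iff at some level `1 ≤ j ≤ jcut` (of its own step `x.1`) its large-field
region has a component that is big for that level (`Node00.KeyBigOldComponent` with site-level touching `Node00.SiteTouch`). [bookkeeping] -/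
def badKeyReadingOfBigComponent₁₃ (N : ℕ) [NeZero N] (K₀ : ℕ) (jcut : ℕ → ℕ) (big : BigDial₁₃ N K₀) : BadKeyReading₁₃ N K₀ :=
  fun F θ hP g₀ os _ x => KeyBigOldComponent SiteTouch (big F θ hP g₀ os x.1) (jcut x.1) x.2

/-- **THE CARDINALITY SIZE DIAL** with thresholds `m K j`: at step `K`, level `j`, a component is big iff it has at least `m K j` finest sites (`Node00.bigOfCard`). [bookkeeping] -/
def bigDialOfCard₁₃ (K₀ : ℕ) (m : ℕ → ℕ → ℕ) : BigDial₁₃ N K₀ :=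
  fun _ _ _ _ _ K j C => bigOfCard (m K) j C

section Reading

variable (θ : Stage13HParams F N) (hP : θ.Provisos₁₃CoPH F N) (K₀ : ℕ) (g₀ : ℕ → ℝ) (os : List (ULoop F))
  (kr : ℕ → (Σ K, SiteSeqKey F (K₀ + K)) → (Σ K, SiteSeqKey F (K₀ + K))) (jcut : ℕ → ℕ) (big : BigDial₁₃ N K₀)

/-- The reading, unfolded at a tuple. [bookkeeping] -/
theorem badKeyReadingOfBigComponent₁₃_apply (K : ℕ) (x : Σ K, SiteSeqKey F (K₀ + K)) :
    badKeyReadingOfBigComponent₁₃ N K₀ jcut big F θ hP g₀ os K x ↔ KeyBigOldComponent SiteTouch (big F θ hP g₀ os x.1) (jcut x.1) x.2 :=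
  Iff.rfl

/-- The cardinality dial, unfolded. [bookkeeping] -/
theorem bigDialOfCard₁₃_apply (m : ℕ → ℕ → ℕ) (K j : ℕ) (C : Set (Site (F.P (K₀ + K)) 0)) :
    bigDialOfCard₁₃ (N := N) K₀ m F θ hP g₀ os K j C ↔ m K j ≤ C.ncard :=
  Iff.rfl

/-! ## §2 The coarse bad class of the reading at any key reading `kr` -/

/-- **MEMBERSHIP**: a coarse class is bad iff it is a coarse class and its key carries an old big component at its own step's cut. [bookkeeping] -/
theorem mem_bad_bigComponent_iff (K : ℕ) (t : ℝ) (u : Σ K, SiteSeqKey F (K₀ + K)) :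
    u ∈ badClassK₁₃ θ K₀ g₀ kr (badKeyReadingOfBigComponent₁₃ N K₀ jcut big F θ hP g₀ os) K t ↔
      u ∈ classSetK₁₃ θ K₀ g₀ kr K ∧ KeyBigOldComponent SiteTouch (big F θ hP g₀ os u.1) (jcut u.1) u.2 :=
  mem_badClassK₁₃_iff θ K₀ g₀ kr _ K t u

/-- ★ **EVERY SIZE DIAL IS A SUB-CLASS OF THE LEVEL CUT**: the component-size bad class lies inside the level-cut bad class of record at the same cut
(`Node00.keyOldLargeField_of_keyBigOldComponent`). [bookkeeping] -/
theorem bad_bigComponent_subset_bad_cut (K : ℕ) (t : ℝ) :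
    badClassK₁₃ θ K₀ g₀ kr (badKeyReadingOfBigComponent₁₃ N K₀ jcut big F θ hP g₀ os) K t ⊆
      badClassK₁₃ θ K₀ g₀ kr (badKeyReadingOfCut₁₃ N K₀ jcut F θ hP g₀ os) K t := by
  intro u hu
  rw [mem_bad_bigComponent_iff] at hu
  exact (mem_badClassK₁₃_iff θ K₀ g₀ kr _ K t u).2 ⟨hu.1, keyOldLargeField_of_keyBigOldComponent SiteTouch hu.2⟩

/-- Monotone in the cut: raising the cut policy pointwise enlarges the class. [bookkeeping] -/
theorem bad_bigComponent_mono_cut {jcut jcut' : ℕ → ℕ} (h : ∀ K, jcut K ≤ jcut' K) (K : ℕ) (t : ℝ) :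
    badClassK₁₃ θ K₀ g₀ kr (badKeyReadingOfBigComponent₁₃ N K₀ jcut big F θ hP g₀ os) K t ⊆
      badClassK₁₃ θ K₀ g₀ kr (badKeyReadingOfBigComponent₁₃ N K₀ jcut' big F θ hP g₀ os) K t := by
  intro u hu
  rw [mem_bad_bigComponent_iff] at hu ⊢
  exact ⟨hu.1, hu.2.mono_cut SiteTouch (h u.1)⟩

/-- Monotone in the dial: weakening the size criterion enlarges the class (raising thresholds shrinks it). [bookkeeping] -/
theorem bad_bigComponent_mono_big {big big' : BigDial₁₃ N K₀} (h : ∀ K j C, big F θ hP g₀ os K j C → big' F θ hP g₀ os K j C) (K : ℕ) (t : ℝ) :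
    badClassK₁₃ θ K₀ g₀ kr (badKeyReadingOfBigComponent₁₃ N K₀ jcut big F θ hP g₀ os) K t ⊆
      badClassK₁₃ θ K₀ g₀ kr (badKeyReadingOfBigComponent₁₃ N K₀ jcut big' F θ hP g₀ os) K t := by
  intro u hu
  rw [mem_bad_bigComponent_iff] at hu ⊢
  exact ⟨hu.1, hu.2.mono_big SiteTouch (h u.1)⟩

/-- ★ **THE `⊤` DIAL IS THE LEVEL-CUT READING**: when every component counts, the component-size bad class IS the level-cut bad class of record
(`Node00.keyBigOldComponent_top_iff`). [bookkeeping] -/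
theorem bad_bigComponent_top_eq_bad_cut (K : ℕ) (t : ℝ) :
    badClassK₁₃ θ K₀ g₀ kr (badKeyReadingOfBigComponent₁₃ N K₀ jcut (fun _ _ _ _ _ _ _ _ => True) F θ hP g₀ os) K t =
      badClassK₁₃ θ K₀ g₀ kr (badKeyReadingOfCut₁₃ N K₀ jcut F θ hP g₀ os) K t := by
  ext u
  rw [mem_bad_bigComponent_iff, mem_badClassK₁₃_iff]
  exact and_congr_right fun _ => keyBigOldComponent_top_iff SiteTouch (jcut u.1) u.2

/-- The `⊤` dial and the level-cut reading agree AS READINGS (propositional extensionality, key by key). [bookkeeping] -/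
theorem badKeyReadingOfBigComponent₁₃_top :
    badKeyReadingOfBigComponent₁₃ N K₀ jcut (fun _ _ _ _ _ _ _ _ => True) = badKeyReadingOfCut₁₃ N K₀ jcut := by
  funext F θ hP g₀ os K x
  exact propext (keyBigOldComponent_top_iff SiteTouch (jcut x.1) x.2)

/-- ★ **THE `⊥` DIAL BOOKS NOTHING**: when no component counts, the bad class is empty at every step and source (`Node00.not_keyBigOldComponent_bot`). [bookkeeping] -/
theorem bad_bigComponent_bot_eq_empty (K : ℕ) (t : ℝ) :
    badClassK₁₃ θ K₀ g₀ kr (badKeyReadingOfBigComponent₁₃ N K₀ jcut (fun _ _ _ _ _ _ _ _ => False) F θ hP g₀ os) K t = ∅ := by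
  ext u
  rw [mem_bad_bigComponent_iff]
  simp only [Finset.notMem_empty, iff_false, not_and]
  exact fun _ => not_keyBigOldComponent_bot SiteTouch (jcut u.1) u.2

/-- Cut policy `0` books nothing, whatever the dial. [bookkeeping] -/
theorem bad_bigComponent_cutZero_eq_empty (K : ℕ) (t : ℝ) :
    badClassK₁₃ θ K₀ g₀ kr (badKeyReadingOfBigComponent₁₃ N K₀ (fun _ => 0) big F θ hP g₀ os) K t = ∅ := by
  ext u
  rw [mem_bad_bigComponent_iff]
  simp only [Finset.notMem_empty, iff_false, not_and]
  exact fun _ => not_keyBigOldComponent_zero SiteTouch _ u.2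

/-! ## §3 The N20 face: descent from the level cut, the free face at the `⊥` dial, and the reading -/

/-- ★★ **ANY WITNESS AT THE LEVEL CUT IS A WITNESS AT EVERY SIZE DIAL** (same `W`, same key reading `kr`): the component-size class is a sub-class of the level-cut class and the
coarse weights of a Stage-13 tuple with core provisos are `≥ 0` (`T4BadClassBooking.relWeightBound_mono` BY NAME). [bookkeeping] -/
theorem relWeightBound_bigComponent_of_cut {W : ℕ → ℝ}
    (h : RelWeightBound 1 (classSetK₁₃ θ K₀ g₀ kr) (weightAK₁₃ θ hP K₀ g₀ os kr) (weightBK₁₃ θ hP K₀ g₀ os kr)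
      (badClassK₁₃ θ K₀ g₀ kr (badKeyReadingOfCut₁₃ N K₀ jcut F θ hP g₀ os)) W) :
    RelWeightBound 1 (classSetK₁₃ θ K₀ g₀ kr) (weightAK₁₃ θ hP K₀ g₀ os kr) (weightBK₁₃ θ hP K₀ g₀ os kr)
      (badClassK₁₃ θ K₀ g₀ kr (badKeyReadingOfBigComponent₁₃ N K₀ jcut big F θ hP g₀ os)) W :=
  relWeightBound_mono h (fun K t _ => bad_bigComponent_subset_bad_cut θ hP K₀ g₀ os kr jcut big K t)
    (fun K t _ u _ => weightAK₁₃_nonneg θ hP K₀ g₀ os kr (fun x _ => weightA₁₃_nonneg F θ hP K₀ g₀ os K t x) u)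
    (fun K t _ u _ => weightBK₁₃_nonneg θ hP K₀ g₀ os kr (fun x _ => weightB₁₃_nonneg F θ hP K₀ g₀ os K t x) u)

/-- A witness at a WEAKER dial is a witness at every stronger one (same `W`). [bookkeeping] -/
theorem relWeightBound_bigComponent_anti {big big' : BigDial₁₃ N K₀} (hb : ∀ K j C, big F θ hP g₀ os K j C → big' F θ hP g₀ os K j C) {W : ℕ → ℝ}
    (h : RelWeightBound 1 (classSetK₁₃ θ K₀ g₀ kr) (weightAK₁₃ θ hP K₀ g₀ os kr) (weightBK₁₃ θ hP K₀ g₀ os kr)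
      (badClassK₁₃ θ K₀ g₀ kr (badKeyReadingOfBigComponent₁₃ N K₀ jcut big' F θ hP g₀ os)) W) :
    RelWeightBound 1 (classSetK₁₃ θ K₀ g₀ kr) (weightAK₁₃ θ hP K₀ g₀ os kr) (weightBK₁₃ θ hP K₀ g₀ os kr)
      (badClassK₁₃ θ K₀ g₀ kr (badKeyReadingOfBigComponent₁₃ N K₀ jcut big F θ hP g₀ os)) W :=
  relWeightBound_mono h (fun K t _ => bad_bigComponent_mono_big θ hP K₀ g₀ os kr jcut hb K t)
    (fun K t _ u _ => weightAK₁₃_nonneg θ hP K₀ g₀ os kr (fun x _ => weightA₁₃_nonneg F θ hP K₀ g₀ os K t x) u)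
    (fun K t _ u _ => weightBK₁₃_nonneg θ hP K₀ g₀ os kr (fun x _ => weightB₁₃_nonneg F θ hP K₀ g₀ os K t x) u)

/-- ★ **THE FREE FACE AT THE `⊥` DIAL**: with no component counting, the bad class is empty and `W := 0` is an admissible relative weight at EVERY key reading, cut policy and tuple —
the cut-zero corner of dag-n20-w2's `…N20KeyedRelWeightCutZero`, now at dial level. [bookkeeping] -/
theorem relWeightBound_bigComponent_bot :
    RelWeightBound 1 (classSetK₁₃ θ K₀ g₀ kr) (weightAK₁₃ θ hP K₀ g₀ os kr) (weightBK₁₃ θ hP K₀ g₀ os kr)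
      (badClassK₁₃ θ K₀ g₀ kr (badKeyReadingOfBigComponent₁₃ N K₀ jcut (fun _ _ _ _ _ _ _ _ => False) F θ hP g₀ os)) (fun _ => 0) where
  bad_subset K t _ := badClassK₁₃_subset θ K₀ g₀ kr _ K t
  nonneg _ := le_rfl
  lt_one _ := zero_lt_one
  summable := summable_zero
  bad_left K t _ := by rw [bad_bigComponent_bot_eq_empty, Finset.sum_empty, zero_mul]
  bad_right K t _ := by rw [bad_bigComponent_bot_eq_empty, Finset.sum_empty, zero_mul]

end Reading

section AtReading

variable (K₀ : ℕ) (kr : KeyReading₁₃ N K₀) (jcut : ℕ → ℕ) (big : BigDial₁₃ N K₀) (sh : ShellSplit₁₃CoPH N K₀) (θ : Stage13HParams F N)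
  (hP : θ.Provisos₁₃CoPH F N) (g₀ : ℕ → ℝ) (os : List (ULoop F))

/-- ★ **N20 AT THE COMPONENT-SIZE READING FROM ANY WITNESS AT THE LEVEL CUT** (same key reading; the reading's canonical `W = wInf …` inherits it by this lineage's
`relWeightBound_crOfRecord₁₃KAt`). [bookkeeping] -/
theorem relWeightBound_crOfRecord₁₃KAt_bigComponent_of_cut {W : ℕ → ℝ}
    (h : RelWeightBound 1 (classSetK₁₃ θ K₀ g₀ (kr F θ hP g₀ os)) (weightAK₁₃ θ hP K₀ g₀ os (kr F θ hP g₀ os)) (weightBK₁₃ θ hP K₀ g₀ os (kr F θ hP g₀ os))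
      (badClassK₁₃ θ K₀ g₀ (kr F θ hP g₀ os) (badKeyReadingOfCut₁₃ N K₀ jcut F θ hP g₀ os)) W) :
    RelWeightBound (crOfRecord₁₃KAt K₀ kr (badKeyReadingOfBigComponent₁₃ N K₀ jcut big) sh F θ hP g₀ os).l₀
      (crOfRecord₁₃KAt K₀ kr (badKeyReadingOfBigComponent₁₃ N K₀ jcut big) sh F θ hP g₀ os).T
      (crOfRecord₁₃KAt K₀ kr (badKeyReadingOfBigComponent₁₃ N K₀ jcut big) sh F θ hP g₀ os).A
      (crOfRecord₁₃KAt K₀ kr (badKeyReadingOfBigComponent₁₃ N K₀ jcut big) sh F θ hP g₀ os).B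
      (crOfRecord₁₃KAt K₀ kr (badKeyReadingOfBigComponent₁₃ N K₀ jcut big) sh F θ hP g₀ os).Bad
      (crOfRecord₁₃KAt K₀ kr (badKeyReadingOfBigComponent₁₃ N K₀ jcut big) sh F θ hP g₀ os).W :=
  relWeightBound_crOfRecord₁₃KAt K₀ kr _ sh θ hP g₀ os (relWeightBound_bigComponent_of_cut θ hP K₀ g₀ os (kr F θ hP g₀ os) jcut big h)

/-- ★ **THE N20 FACE AT THE `⊥` DIAL HOLDS OUTRIGHT** at the reading, every key reading, cut policy and tuple (the canonical `W` inherits the zero witness). [bookkeeping] -/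
theorem relWeightBound_crOfRecord₁₃KAt_bigComponent_bot :
    RelWeightBound (crOfRecord₁₃KAt K₀ kr (badKeyReadingOfBigComponent₁₃ N K₀ jcut fun _ _ _ _ _ _ _ _ => False) sh F θ hP g₀ os).l₀
      (crOfRecord₁₃KAt K₀ kr (badKeyReadingOfBigComponent₁₃ N K₀ jcut fun _ _ _ _ _ _ _ _ => False) sh F θ hP g₀ os).T
      (crOfRecord₁₃KAt K₀ kr (badKeyReadingOfBigComponent₁₃ N K₀ jcut fun _ _ _ _ _ _ _ _ => False) sh F θ hP g₀ os).A
      (crOfRecord₁₃KAt K₀ kr (badKeyReadingOfBigComponent₁₃ N K₀ jcut fun _ _ _ _ _ _ _ _ => False) sh F θ hP g₀ os).B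
      (crOfRecord₁₃KAt K₀ kr (badKeyReadingOfBigComponent₁₃ N K₀ jcut fun _ _ _ _ _ _ _ _ => False) sh F θ hP g₀ os).Bad
      (crOfRecord₁₃KAt K₀ kr (badKeyReadingOfBigComponent₁₃ N K₀ jcut fun _ _ _ _ _ _ _ _ => False) sh F θ hP g₀ os).W :=
  relWeightBound_crOfRecord₁₃KAt K₀ kr _ sh θ hP g₀ os (relWeightBound_bigComponent_bot θ hP K₀ g₀ os (kr F θ hP g₀ os) jcut)

/-- The bad class OF THE READING at a tuple, unfolded. [bookkeeping] -/
theorem crOfRecord₁₃KAt_bigComponent_Bad :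
    (crOfRecord₁₃KAt K₀ kr (badKeyReadingOfBigComponent₁₃ N K₀ jcut big) sh F θ hP g₀ os).Bad =
      badClassK₁₃ θ K₀ g₀ (kr F θ hP g₀ os) (badKeyReadingOfBigComponent₁₃ N K₀ jcut big F θ hP g₀ os) :=
  rfl

/-- ★ **THE `⊤` DIAL GIVES BACK THE LEVEL-CUT READING** (as spine readings, every key reading `kr`). [bookkeeping] -/
theorem crOfRecord₁₃KAt_bigComponent_top :
    crOfRecord₁₃KAt K₀ kr (badKeyReadingOfBigComponent₁₃ N K₀ jcut fun _ _ _ _ _ _ _ _ => True) sh = crOfRecord₁₃KAt K₀ kr (badKeyReadingOfCut₁₃ N K₀ jcut) sh := by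
  rw [badKeyReadingOfBigComponent₁₃_top]

/-- ★ **… AND AT THE IDENTITY DIAL THE V EDITION OF RECORD** `crOfRecord₁₃VAt K₀ jcut sh` (v5's pin; this lineage's `crOfRecord₁₃KAt_id`) — so the component-size readings at
`kr := keyReadingId₁₃` interpolate between the pinned record (`⊤` dial) and the free face (`⊥` dial) at ONE cut policy. [bookkeeping] -/
theorem crOfRecord₁₃KAt_id_bigComponent_top :
    crOfRecord₁₃KAt K₀ (keyReadingId₁₃ N K₀) (badKeyReadingOfBigComponent₁₃ N K₀ jcut fun _ _ _ _ _ _ _ _ => True) sh = crOfRecord₁₃VAt K₀ jcut sh := by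
  rw [crOfRecord₁₃KAt_bigComponent_top, crOfRecord₁₃KAt_id]

end AtReading

/-! ## §4 The cardinality instance -/

section Card

variable (θ : Stage13HParams F N) (hP : θ.Provisos₁₃CoPH F N) (K₀ : ℕ) (g₀ : ℕ → ℝ) (os : List (ULoop F))
  (kr : ℕ → (Σ K, SiteSeqKey F (K₀ + K)) → (Σ K, SiteSeqKey F (K₀ + K))) (jcut : ℕ → ℕ)

/-- Membership at the cardinality dial: bad iff a coarse class whose key has, at some level `1 ≤ j ≤ jcut (own step)`, a component of `Z_j` with at least `m (own step) j` finest
sites. [bookkeeping] -/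
theorem mem_bad_card_iff (m : ℕ → ℕ → ℕ) (K : ℕ) (t : ℝ) (u : Σ K, SiteSeqKey F (K₀ + K)) :
    u ∈ badClassK₁₃ θ K₀ g₀ kr (badKeyReadingOfBigComponent₁₃ N K₀ jcut (bigDialOfCard₁₃ K₀ m) F θ hP g₀ os) K t ↔
      u ∈ classSetK₁₃ θ K₀ g₀ kr K ∧ KeyBigOldComponent SiteTouch (bigOfCard (m u.1)) (jcut u.1) u.2 :=
  mem_bad_bigComponent_iff θ hP K₀ g₀ os kr jcut _ K t u

/-- ★ **THRESHOLDS `0` GIVE THE LEVEL-CUT READING BACK** (`Node00.keyBigOldComponent_card_iff_of_eq_zero`). [bookkeeping] -/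
theorem bad_card_eq_bad_cut_of_eq_zero {m : ℕ → ℕ → ℕ} (hm : ∀ K j, m K j = 0) (K : ℕ) (t : ℝ) :
    badClassK₁₃ θ K₀ g₀ kr (badKeyReadingOfBigComponent₁₃ N K₀ jcut (bigDialOfCard₁₃ K₀ m) F θ hP g₀ os) K t =
      badClassK₁₃ θ K₀ g₀ kr (badKeyReadingOfCut₁₃ N K₀ jcut F θ hP g₀ os) K t := by
  ext u
  rw [mem_bad_card_iff, mem_badClassK₁₃_iff]
  exact and_congr_right fun _ => keyBigOldComponent_card_iff_of_eq_zero SiteTouch (hm u.1) (jcut u.1) u.2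

/-- Thresholds `1` give the level-cut reading back too (components are nonempty; the torus is finite). [bookkeeping] -/
theorem bad_card_eq_bad_cut_of_eq_one {m : ℕ → ℕ → ℕ} (hm : ∀ K j, m K j = 1) (K : ℕ) (t : ℝ) :
    badClassK₁₃ θ K₀ g₀ kr (badKeyReadingOfBigComponent₁₃ N K₀ jcut (bigDialOfCard₁₃ K₀ m) F θ hP g₀ os) K t =
      badClassK₁₃ θ K₀ g₀ kr (badKeyReadingOfCut₁₃ N K₀ jcut F θ hP g₀ os) K t := by
  ext u
  rw [mem_bad_card_iff, mem_badClassK₁₃_iff]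
  exact and_congr_right fun _ => keyBigOldComponent_card_iff_of_eq_one SiteTouch (hm u.1) (jcut u.1) u.2

/-- **THRESHOLDS ABOVE THE NUMBER OF FINEST SITES BOOK NOTHING** (`Node00.not_keyBigOldComponent_card_of_card_lt`). [bookkeeping] -/
theorem bad_card_eq_empty_of_card_lt {m : ℕ → ℕ → ℕ} (hm : ∀ K j, 1 ≤ j → Nat.card (Site (F.P (K₀ + K)) 0) < m K j) (K : ℕ) (t : ℝ) :
    badClassK₁₃ θ K₀ g₀ kr (badKeyReadingOfBigComponent₁₃ N K₀ jcut (bigDialOfCard₁₃ K₀ m) F θ hP g₀ os) K t = ∅ := by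
  ext u
  rw [mem_bad_card_iff]
  simp only [Finset.notMem_empty, iff_false, not_and]
  exact fun _ => not_keyBigOldComponent_card_of_card_lt SiteTouch (hm u.1) (jcut u.1) u.2

/-- Antitone in the thresholds: raising them pointwise shrinks the class. [bookkeeping] -/
theorem bad_card_anti {m m' : ℕ → ℕ → ℕ} (h : ∀ K j, m K j ≤ m' K j) (K : ℕ) (t : ℝ) :
    badClassK₁₃ θ K₀ g₀ kr (badKeyReadingOfBigComponent₁₃ N K₀ jcut (bigDialOfCard₁₃ K₀ m') F θ hP g₀ os) K t ⊆
      badClassK₁₃ θ K₀ g₀ kr (badKeyReadingOfBigComponent₁₃ N K₀ jcut (bigDialOfCard₁₃ K₀ m) F θ hP g₀ os) K t :=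
  bad_bigComponent_mono_big θ hP K₀ g₀ os kr jcut (fun K j _ hC => bigOfCard_anti (h K) j hC) K t

/-- ★ A witness at thresholds `m` is a witness at every pointwise LARGER threshold `m'` (same `W`): the (AC)-type booking only gets easier as the size criterion sharpens.
[bookkeeping] -/
theorem relWeightBound_card_anti {m m' : ℕ → ℕ → ℕ} (hle : ∀ K j, m K j ≤ m' K j) {W : ℕ → ℝ}
    (h : RelWeightBound 1 (classSetK₁₃ θ K₀ g₀ kr) (weightAK₁₃ θ hP K₀ g₀ os kr) (weightBK₁₃ θ hP K₀ g₀ os kr)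
      (badClassK₁₃ θ K₀ g₀ kr (badKeyReadingOfBigComponent₁₃ N K₀ jcut (bigDialOfCard₁₃ K₀ m) F θ hP g₀ os)) W) :
    RelWeightBound 1 (classSetK₁₃ θ K₀ g₀ kr) (weightAK₁₃ θ hP K₀ g₀ os kr) (weightBK₁₃ θ hP K₀ g₀ os kr)
      (badClassK₁₃ θ K₀ g₀ kr (badKeyReadingOfBigComponent₁₃ N K₀ jcut (bigDialOfCard₁₃ K₀ m') F θ hP g₀ os)) W :=
  relWeightBound_bigComponent_anti θ hP K₀ g₀ os kr jcut (fun K j _ hC => bigOfCard_anti (hle K) j hC) h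

end Card

end YMDAG.UVSplit

end
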